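import Literature.AnabelianGeometry.EtaleTheta.ThetaCohomologyAnchored
import Summits.ABC.IUTFork.LanaEtaEvaluation
import HarnessLib

/-!
# L-LANA objects XI quinquies, sequel: LANA's CONTAINMENT from the ANCHORED form of [EtTh] Prop. 1.4 (iii)

Record-only, proof-only sequel (D-0012; seat abc-iut-c312-4 gen 5, L-LANA level, plan/LLANA-SPEC N14) of
`LanaEtaEvaluation.lean` (gen 3); TAKES NO SIDE on [IUTchIII] Cor. 3.12. REPAIR of finding **F-w4d025-1**
(vacuity-at-instantiation, kernel-certified 2026-08-26T03:55Z, `HOME/staging/w4/w4-d025/audit/ProbeF0590LanaVacuity.lean`):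
gen 3's five discharge theorems bind `h14 : ThetaSetting.Prop14iiiValues E` (FACT-LIST F-0590), a `∀`-statement
over layer L2's UN-anchored records `NonCuspidalPoint` (decomposition group, coordinate and evaluation map as
independent data) which layer L2 REFUTED from any single point (`not_prop14iiiValues`, the re-coordinatisation
`y ↦ (D_y, q̈·Ü(y), evalAt)` and the functional equation of Prop. 1.4 (ii)) — so those theorems hold only vacuously
wherever an evaluation point exists. Layer L2's owner repair (abc-iut-L2-t1, `ThetaCohomologyAnchored.lean`):
`ThetaSetting.AnchoredPoint` = `NonCuspidalPoint` + the two printed sentences "`H¹(G_L, Δ_Θ) ≅ (L^×)^∧`"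
(`evalAt_injective`) and "`log(Ü)|_y = Ü(y)`" (`evalAt_logUdd`, the coordinate is THE coordinate of the point), and
the corrected statement `Prop14iiiValuesAnchored E` (same wording, anchored points; a weakening of the struck form,
NOT asserted). THIS file re-bases the discharge on it, keeping gen 3's signature `EtaEvalSide` and its
`K̈`-rational points `S.pts t` and asking that they be ANCHORED (`hev`, as before, and the new `hlog`; the anchored point is the
structure literal `⟨S.pts t, hev, hlog⟩`, no new definition):

* `res_thetaClass_mem_mrange_kappaAt_anchored` — theta classes restrict into `κ_t(O^▷_{K̈})` at an anchored point,
  GIVEN `Prop14iiiValuesAnchored E` and integrality of `Θ̈(y_t)`;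
* `thetaMonoidEt_le_comap_anchored` — the whole étale-like theta monoid `O^×(Π_v)·⟨θ(Π_v)⟩` does;
* **`containment_of_prop14iiiAnchored`**, `factors_of_prop14iiiAnchored`, `containment_of_prop14iiiAnchored_of_unit_coords`
  — LANA's Containment / §9.1 (f) factorisation for the [EtTh]-level signature from the p. 34 link `KummerImageEq`,
  the ANCHORED Prop. 1.4 (iii), anchoring of the points and integrality (discharged at unit coordinates).

HONEST SCOPE (unchanged from gen 3 except (iii)). (i) Level: [EtTh] §1, `∞θ := ⟨θ⟩`. (ii) Points `K̈`-rational.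
(iii) Hypotheses: `KummerImageEq`, `Prop14iiiValuesAnchored` (layer L2's corrected typing of a refereed statement;
neither proved nor refuted in the tree), `hev`/`hlog` (anchoring), `hint`. NON-VACUITY of the conjunction is NOT
witnessed here: layer L2 reports (STATUS 2026-08-26T03:58Z (C)) that over its discrete consistency model `KummerData`
is empty, and a joint model needs the cyclotomic action on `Δ_Θ` (Kummer theory of the Tate curve) — open, recorded.
[cite: LANA2026Report, §6.2 (g) p. 36] [cite: MochizukiEtTh2009, Prop 1.4 (iii) p.22] NOT here: any judgement.
-/

noncomputable section

namespace Summit.ABC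
namespace IUTFork

open Literature.AnabelianGeometry.EtaleTheta
open scoped NNReal

variable {p : ℕ} [Fact p.Prime]

namespace EtaEvalSide

variable {D : ThetaSetting p} {E : D.EtaleThetaData} (S : EtaEvalSide E)

/-- **Theta classes restrict into `κ_t(O^▷)` at an ANCHORED point, GIVEN the anchored [EtTh] Prop. 1.4 (iii)**:
for `x ∈ O^×_K̈ · η̈^Θ`, `res_{y_t}(x) = κ_{y_t}(a · Θ̈(y_t))` with `a ∈ O^×_K̈`, provided `y_t` is anchored (`hev`,
`hlog`) and the theta value at `y_t` is integral (`hint`). [cite: MochizukiEtTh2009, Prop 1.4 (iii) p.22]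
[cite: LANA2026Report, §6.2 (f) p. 35] -/
theorem res_thetaClass_mem_mrange_kappaAt_anchored (h14 : ThetaSetting.Prop14iiiValuesAnchored E) (t : S.T)
    (hev : Function.Injective (S.pts t).evalAt)
    (hlog : (S.pts t).evalAt (ContH1.res D.toTheta D.DeltaTheta (S.pts t).Dpt_le
      (D.inflTheta D.GtpYdd E.toKummerData.logUdd)) = E.toKddHat (S.pts t).coord)
    (hint : ‖thetaDdot D.qdd (((S.pts t).coord : D.Kdd) : PadicAlgCl p)‖ ≤ 1)
    (x : D.H1 D.GtpYdd) (hx : x ∈ E.thetaClasses) :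
    ContH1.res D.toTheta D.DeltaTheta (S.pts t).Dpt_le x ∈ MonoidHom.mrange (EtTh.kappaAt E (S.pts t)) := by
  obtain ⟨a, ha, v, hv, heval⟩ :=
    h14 { toNonCuspidalPoint := S.pts t, evalAt_injective := hev, evalAt_logUdd := hlog } x hx
  have hav : a * v ∈ EtTh.intUnitsKdd D := by
    rw [EtTh.mem_intUnitsKdd_iff, Units.val_mul, IntermediateField.coe_mul, norm_mul]
    have ha' : ‖((a : D.Kdd) : PadicAlgCl p)‖ = 1 := ha
    rw [ha', one_mul, hv]
    exact hint
  refine ⟨⟨a * v, hav⟩, hev ?_⟩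
  rw [EtTh.evalAt_kappaAt]
  exact heval.symm

/-- **The whole étale-like theta monoid restricts into `κ_t(O^▷)` at an anchored point** when `∞θ := ⟨θ⟩`.
[cite: LANA2026Report, §6.2 (d) p. 34, §6.2 (g) p. 36] -/
theorem thetaMonoidEt_le_comap_anchored (hInf : S.thetaInf = Submonoid.closure E.thetaClasses)
    (h14 : ThetaSetting.Prop14iiiValuesAnchored E) (t : S.T) (hev : Function.Injective (S.pts t).evalAt)
    (hlog : (S.pts t).evalAt (ContH1.res D.toTheta D.DeltaTheta (S.pts t).Dpt_le
      (D.inflTheta D.GtpYdd E.toKummerData.logUdd)) = E.toKddHat (S.pts t).coord)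
    (hint : ‖thetaDdot D.qdd (((S.pts t).coord : D.Kdd) : PadicAlgCl p)‖ ≤ 1) :
    S.toEtaSteps.thetaMonoidEt ≤ (MonoidHom.mrange (EtTh.kappaAt E (S.pts t))).comap (S.toEtaSteps.res t) := by
  change E.kumUnitsYdd.toSubmonoid ⊔ S.thetaInf ≤ _
  rw [hInf]
  refine sup_le (fun x hx => ?_) (Submonoid.closure_le.mpr fun x hx => ?_)
  · exact S.res_unit_mem_mrange_kappaAt t x hx
  · exact S.res_thetaClass_mem_mrange_kappaAt_anchored h14 t hev hlog hint x hx

/-- **LANA's CONTAINMENT from the ANCHORED [EtTh] Prop. 1.4 (iii)** (repair of F-w4d025-1). For the [EtTh]-level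
signature with `K̈`-rational ANCHORED evaluation points and `∞θ := ⟨θ⟩`: if the Frobenioid-theoretic theta monoid
has Kummer image `M^Θ = O^×(Π_v)·∞θ(Π_v)` (`KummerImageEq`), the anchored Prop. 1.4 (iii) holds
(`Prop14iiiValuesAnchored`), every `y_t` is anchored (`hev`, `hlog`) and the theta values `Θ̈(y_t)` are integral —
THEN "the image of `ψ_v` is contained in the image of `φ_v`" (p. 36). [cite: LANA2026Report, §6.2 (g) p. 36]
[cite: MochizukiEtTh2009, Prop 1.4 (iii) p.22] -/
theorem containment_of_prop14iiiAnchored (hInf : S.thetaInf = Submonoid.closure E.thetaClasses)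
    (hK : S.toEtaSteps.KummerImageEq) (h14 : ThetaSetting.Prop14iiiValuesAnchored E)
    (hev : ∀ t, Function.Injective (S.pts t).evalAt)
    (hlog : ∀ t, (S.pts t).evalAt (ContH1.res D.toTheta D.DeltaTheta (S.pts t).Dpt_le
      (D.inflTheta D.GtpYdd E.toKummerData.logUdd)) = E.toKddHat (S.pts t).coord)
    (hint : ∀ t, ‖thetaDdot D.qdd (((S.pts t).coord : D.Kdd) : PadicAlgCl p)‖ ≤ 1) :
    S.toEtaSteps.Containment := by
  rintro _ ⟨m, rfl⟩
  have hm : S.rgd (S.kum m) ∈ S.toEtaSteps.thetaMonoidEt := S.toEtaSteps.rgd_kum_mem_thetaMonoidEt hK m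
  have hcomp : ∀ t, ∃ o : ↥(EtTh.intUnitsKdd D),
      EtTh.kappaAt E (S.pts t) o = ContH1.res D.toTheta D.DeltaTheta (S.pts t).Dpt_le (S.rgd (S.kum m)) :=
    fun t => S.thetaMonoidEt_le_comap_anchored hInf h14 t (hev t) (hlog t) (hint t) hm
  choose o ho using hcomp
  refine ⟨o, funext fun t => ?_⟩
  rw [EtaSteps.phiProd_apply, toEtaSteps_phi_apply, toEtaSteps_psi_apply, ho]

/-- … hence the §9.1 (f) factorisation `λ` through `∏_t O^▷` EXISTS (and is unique), same hypotheses.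
[cite: LANA2026Report, §9.1 (f) p. 45] -/
theorem factors_of_prop14iiiAnchored (hInf : S.thetaInf = Submonoid.closure E.thetaClasses)
    (hK : S.toEtaSteps.KummerImageEq) (h14 : ThetaSetting.Prop14iiiValuesAnchored E)
    (hev : ∀ t, Function.Injective (S.pts t).evalAt)
    (hlog : ∀ t, (S.pts t).evalAt (ContH1.res D.toTheta D.DeltaTheta (S.pts t).Dpt_le
      (D.inflTheta D.GtpYdd E.toKummerData.logUdd)) = E.toKddHat (S.pts t).coord)
    (hint : ∀ t, ‖thetaDdot D.qdd (((S.pts t).coord : D.Kdd) : PadicAlgCl p)‖ ≤ 1) :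
    S.toEtaSteps.Factors :=
  S.toEtaSteps_containment_iff_factors.mp (S.containment_of_prop14iiiAnchored hInf hK h14 hev hlog hint)

/-- **Containment from the anchored Prop. 1.4 (iii) at ANCHORED points with UNIT coordinates** — integrality
discharged (`EtTh.norm_thetaDdot_coord_le_one`). [cite: LANA2026Report, §6.2 (g) p. 36]
[cite: MochizukiEtTh2009, Prop 1.4 (iii) p.22] -/
theorem containment_of_prop14iiiAnchored_of_unit_coords (hInf : S.thetaInf = Submonoid.closure E.thetaClasses)
    (hK : S.toEtaSteps.KummerImageEq) (h14 : ThetaSetting.Prop14iiiValuesAnchored E)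
    (hev : ∀ t, Function.Injective (S.pts t).evalAt)
    (hlog : ∀ t, (S.pts t).evalAt (ContH1.res D.toTheta D.DeltaTheta (S.pts t).Dpt_le
      (D.inflTheta D.GtpYdd E.toKummerData.logUdd)) = E.toKddHat (S.pts t).coord)
    (hunit : ∀ t, ‖(((S.pts t).coord : D.Kdd) : PadicAlgCl p)‖ = 1) :
    S.toEtaSteps.Containment :=
  S.containment_of_prop14iiiAnchored hInf hK h14 hev hlog fun t =>
    EtTh.norm_thetaDdot_coord_le_one E (S.pts t) (hunit t)

end EtaEvalSide

end IUTFork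

end Summit.ABC

end
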